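import Mathlib
import HarnessLib
import Summits.HubbardSuperconductivity.HubbardSuperconductivity.Theorems.KLProgrammeKLRegimeTwoVolumeGridPeriodisationLegs
import Summits.HubbardSuperconductivity.HubbardSuperconductivity.Theorems.KLProgrammeH10TwoPointLimitOverlapKernelCharSum

/-!
# Route `KLProgramme` — crux K3, the nested two-volume pass at the sectorised scales: the sector-multiplier OVERLAP KERNEL `E′ S`
# periodises EXACTLY between nested tori and is spatially translation-covariant (cell gate-hubbard-kl, seat hubbard-kl-k3c4-p1 g8; `--supports` stmt-…-20440)

The resectorisation between consecutive scales and the read-out of the sectorised single-scale step (`Literature.…SectorisedEffectiveActionBound*`: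
`map (toLin' E′) (effAction C G) = map (toLin' (E′ S)) (effAction (Sᵀ C S) (sectorPreimage …))`) push kernels forward through the OVERLAP KERNEL
`(E′ S)((y,(ω′,σ,c)),(x,(ω,σ,c))) = (βV²)⁻¹ Σ_k pw_c(k,y) conj(pw_c(k,x)) F′_{ω′}(k) F_ω(k)` (`HubbardSectorFieldSubstitution.sectorAnalysis_mul_sectorSub_apply`,
p4's `…H10TwoPointLimitOverlapKernelCharSum.overlapKernel_eq`).  In the two-volume pass (VL-STUB-ROUTE-A-g8.md §3 (iv)) the defect
`map (toLin' E′S′) (Glue V) − Glue (map (toLin' E S) V)` at deep pins is a sum of WINDING terms, because the substitution kernel of the fine torus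
`Lf = b·L` summed over the fibre of a coarse column label IS the coarse kernel — the periodisation hypothesis `(P_t)` of that bracket.  Here, for SAMPLED
multiplier families `F_V ω (i,q) = 𝔣 ω i (p_q)`, `F′_V ω′ (i,q) = 𝔣′ ω′ i (p_q)` (the programme's: `…TwoVolumeSectorPeriodisation.klAnisoFamily_eq_sampled`):

* §1 per frequency the summand is `T_i(x₀,y₀) · χ_q(±(x⃗ − y⃗)) · ψ_i(p_q)` (`overlapSummand_zero_eq/_one_eq`, via `overlapPhase_zero/one` and
  `conj_hubbardPlaneWave_mul_conj_hubbardPlaneWave`), and `(βV²)⁻¹ Σ_q T χ_q ψ(p_q) = (T/β)·(V⁻² Σ_q ψ(p_q) χ_q)` (`inv_mul_sum_overlapSummand_eq`);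
* §2 **`sectorOverlap_zero_periodise` / `sectorOverlap_one_periodise`** — per charge, the fine overlap kernel summed over the site fibre of the column is the
  coarse one at the projected row (`periodise_spatialPropagator(_left)`);
* §3 **`sectorOverlap_periodise_leg`** — `(P_t)` at every pair of labels for any block structure `e₁` of the column labels whose projection is
  `((x₀,x⃗),ℓ) ↦ ((x₀, red x⃗), ℓ)` (rows projected the same way): `Σ_{π Y″ = Y} (E′_{Lf} S_{Lf}) X′ Y″ = (E′_L S_L) (π X′) Y`;
* §4 `sectorOverlap_translate` — spatial translation covariance `(E′S)((y₀,y⃗+z),ℓ′)((x₀,x⃗+z),ℓ) = (E′S)((y₀,y⃗),ℓ′)((x₀,x⃗),ℓ)` (any multipliers; the box-shift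
  identity behind the winding COLUMN tails of §3 (iv)).

Everything is proved; no definition; nothing is asserted about the model.  References: BGM 2006 §2.1 (2.5), §2.7 (2.70)–(2.71a).
-/

noncomputable section

namespace Summit.HubbardSuperconductivity.HubbardSuperconductivity.Theorems.TwoPointAssembly

set_option linter.dupNamespace false -- summit = problem name (single-conjunct summit), D-0017

open Finset Complex Literature.MathematicalPhysics.QuantumLattice Literature.Probability.LatticeModels
open Summit.HubbardSuperconductivity.HubbardSuperconductivity.Theorems.TorusFourierL2
open scoped ComplexConjugate

/-! ## §1 The overlap summand per frequency, for sampled multipliers -/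

section Summand

variable {V M N N' : ℕ} [NeZero V] [NeZero M]

/-- `(βV²)⁻¹ · Σ_q (T · χ_q(z) · ψ(p_q)) = (T/β) · (V⁻² Σ_q ψ(p_q) χ_q(z))` (`β ≠ 0`). [folklore] -/
theorem inv_mul_sum_overlapSummand_eq {β : ℝ} (hβ : β ≠ 0) (T : ℂ) (ψ : (Fin 2 → ℝ) → ℂ) (z : TorusSite 2 V) :
    ((1 / (β * (V : ℝ) ^ 2) : ℝ) : ℂ) * ∑ q : TorusSite 2 V, T * torusChar q z * ψ (latticeMomentum V q) =
      (T / (β : ℂ)) * (((V : ℂ) ^ 2)⁻¹ * ∑ q : TorusSite 2 V, ψ (latticeMomentum V q) * torusChar q z) := by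
  rw [Finset.mul_sum, Finset.mul_sum, Finset.mul_sum]
  refine Finset.sum_congr rfl fun q _ => ?_
  have hV : (V : ℂ) ≠ 0 := by exact_mod_cast NeZero.ne V
  have hβ' : (β : ℂ) ≠ 0 := by exact_mod_cast hβ
  push_cast
  field_simp

/-- Charge `0`: the overlap summand with SAMPLED multipliers is `T_i(x₀,y₀) · χ_q(x⃗ − y⃗) · ψ_i(p_q)`, `ψ_i(p) = 𝔣′ ω′ i p · 𝔣 ω i p`, `T` the volume-free temporal
phase of `conj_hubbardPlaneWave_mul_conj_hubbardPlaneWave`. [folklore] -/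
theorem overlapSummand_zero_eq {β : ℝ} (hβ : β ≠ 0)
    (𝔣' : Fin N' → MatsubaraIdx M → (Fin 2 → ℝ) → ℂ) (𝔣 : Fin N → MatsubaraIdx M → (Fin 2 → ℝ) → ℂ)
    (F' : Fin N' → FreqMomentum V M → ℂ) (hF' : ∀ ω i q, F' ω (i, q) = 𝔣' ω i (latticeMomentum V q))
    (F : Fin N → FreqMomentum V M → ℂ) (hF : ∀ ω i q, F ω (i, q) = 𝔣 ω i (latticeMomentum V q))
    (ω' : Fin N') (ω : Fin N) (y₀ x₀ : ImagTimeIdx M) (y x : TorusSite 2 V)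
    (ψ : MatsubaraIdx M → (Fin 2 → ℝ) → ℂ) (hψ : ∀ i q', 𝔣' ω' i q' * 𝔣 ω i q' = ψ i q') (i : MatsubaraIdx M) (q : TorusSite 2 V) :
    hubbardPlaneWave V M β 0 (i, q) (y₀, y) * conj (hubbardPlaneWave V M β 0 (i, q) (x₀, x)) * (F' ω' (i, q) * F ω (i, q)) =
      (Complex.exp (((Real.pi * (1 - 2 * M) * (((x₀ : ℕ) : ℝ) - ((y₀ : ℕ) : ℝ)) / (2 * M) : ℝ) : ℂ) * I) *
          torusChar (fun _ : Fin 1 => ((i : ℕ) : ZMod (2 * M))) (fun _ : Fin 1 => ((x₀ : ℕ) : ZMod (2 * M)) - ((y₀ : ℕ) : ZMod (2 * M)))) *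
        torusChar q (x - y) * ψ i (latticeMomentum V q) := by
  have hpw := conj_hubbardPlaneWave_mul_conj_hubbardPlaneWave (L := V) (M := M) hβ (i, q) (x₀, x) (y₀, y)
  dsimp only at hpw
  rw [overlapPhase_zero, hpw, hF', hF, ← hψ]
  ring

/-- Charge `1`: the overlap summand with SAMPLED multipliers is `T_i(y₀,x₀) · χ_q(y⃗ − x⃗) · ψ_i(p_q)`. [folklore] -/
theorem overlapSummand_one_eq {β : ℝ} (hβ : β ≠ 0)
    (𝔣' : Fin N' → MatsubaraIdx M → (Fin 2 → ℝ) → ℂ) (𝔣 : Fin N → MatsubaraIdx M → (Fin 2 → ℝ) → ℂ)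
    (F' : Fin N' → FreqMomentum V M → ℂ) (hF' : ∀ ω i q, F' ω (i, q) = 𝔣' ω i (latticeMomentum V q))
    (F : Fin N → FreqMomentum V M → ℂ) (hF : ∀ ω i q, F ω (i, q) = 𝔣 ω i (latticeMomentum V q))
    (ω' : Fin N') (ω : Fin N) (y₀ x₀ : ImagTimeIdx M) (y x : TorusSite 2 V)
    (ψ : MatsubaraIdx M → (Fin 2 → ℝ) → ℂ) (hψ : ∀ i q', 𝔣' ω' i q' * 𝔣 ω i q' = ψ i q') (i : MatsubaraIdx M) (q : TorusSite 2 V) :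
    hubbardPlaneWave V M β 1 (i, q) (y₀, y) * conj (hubbardPlaneWave V M β 1 (i, q) (x₀, x)) * (F' ω' (i, q) * F ω (i, q)) =
      (Complex.exp (((Real.pi * (1 - 2 * M) * (((y₀ : ℕ) : ℝ) - ((x₀ : ℕ) : ℝ)) / (2 * M) : ℝ) : ℂ) * I) *
          torusChar (fun _ : Fin 1 => ((i : ℕ) : ZMod (2 * M))) (fun _ : Fin 1 => ((y₀ : ℕ) : ZMod (2 * M)) - ((x₀ : ℕ) : ZMod (2 * M)))) *
        torusChar q (y - x) * ψ i (latticeMomentum V q) := by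
  have hpw := conj_hubbardPlaneWave_mul_conj_hubbardPlaneWave (L := V) (M := M) hβ (i, q) (y₀, y) (x₀, x)
  dsimp only at hpw
  rw [overlapPhase_one, hpw, hF', hF, ← hψ]
  ring

end Summand

/-! ## §2 The overlap kernel periodises in the column fibre, per charge -/

section Periodise

variable {b L Lf M N N' : ℕ} [NeZero Lf] [NeZero L] [NeZero M]

/-- **Charge `0`: the fine overlap kernel summed over the site fibre of the column label is the coarse one at the projected row.**  For `Lf = b·L`, `β ≠ 0`, the
SAME sampled families `𝔣′`, `𝔣` at both volumes:
`Σ_{red x⃗′ = x̄} (E′_{Lf}S_{Lf})(((y₀,y⃗),(ω′,σ,+)),((x₀,x⃗′),(ω,σ,+))) = (E′_L S_L)(((y₀, red y⃗),(ω′,σ,+)),((x₀,x̄),(ω,σ,+)))`. [folklore] -/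
theorem sectorOverlap_zero_periodise (hLf : Lf = b * L) {β : ℝ} (hβ : β ≠ 0)
    (𝔣' : Fin N' → MatsubaraIdx M → (Fin 2 → ℝ) → ℂ) (𝔣 : Fin N → MatsubaraIdx M → (Fin 2 → ℝ) → ℂ)
    (F'L : Fin N' → FreqMomentum L M → ℂ) (F'Lf : Fin N' → FreqMomentum Lf M → ℂ)
    (hF'L : ∀ ω i q, F'L ω (i, q) = 𝔣' ω i (latticeMomentum L q)) (hF'Lf : ∀ ω i q, F'Lf ω (i, q) = 𝔣' ω i (latticeMomentum Lf q))
    (FL : Fin N → FreqMomentum L M → ℂ) (FLf : Fin N → FreqMomentum Lf M → ℂ)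
    (hFL : ∀ ω i q, FL ω (i, q) = 𝔣 ω i (latticeMomentum L q)) (hFLf : ∀ ω i q, FLf ω (i, q) = 𝔣 ω i (latticeMomentum Lf q))
    (y₀ x₀ : ImagTimeIdx M) (y : TorusSite 2 Lf) (xbar : TorusSite 2 L) (ω' : Fin N') (ω : Fin N) (σ : Fin 2) :
    ∑ x' ∈ univ.filter (fun x' : TorusSite 2 Lf => (fun i => (((x' i).val : ℕ) : ZMod L)) = xbar),
        (sectorAnalysisMatrix Lf M β F'Lf * sectorSubMatrix Lf M β FLf) ((y₀, y), ((ω', σ), 0)) ((x₀, x'), ((ω, σ), 0)) =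
      (sectorAnalysisMatrix L M β F'L * sectorSubMatrix L M β FL)
        ((y₀, fun i => (((y i).val : ℕ) : ZMod L)), ((ω', σ), 0)) ((x₀, xbar), ((ω, σ), 0)) := by
  obtain ⟨ψ, hψ⟩ : ∃ ψ : MatsubaraIdx M → (Fin 2 → ℝ) → ℂ, ∀ i q', 𝔣' ω' i q' * 𝔣 ω i q' = ψ i q' := ⟨_, fun _ _ => rfl⟩
  have hfine : ∀ x' : TorusSite 2 Lf,
      (sectorAnalysisMatrix Lf M β F'Lf * sectorSubMatrix Lf M β FLf) ((y₀, y), ((ω', σ), 0)) ((x₀, x'), ((ω, σ), 0)) =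
        ∑ i : MatsubaraIdx M,
          (Complex.exp (((Real.pi * (1 - 2 * M) * (((x₀ : ℕ) : ℝ) - ((y₀ : ℕ) : ℝ)) / (2 * M) : ℝ) : ℂ) * I) *
              torusChar (fun _ : Fin 1 => ((i : ℕ) : ZMod (2 * M))) (fun _ : Fin 1 => ((x₀ : ℕ) : ZMod (2 * M)) - ((y₀ : ℕ) : ZMod (2 * M)))) /
              (β : ℂ) *
            (((Lf : ℂ) ^ 2)⁻¹ * ∑ q : TorusSite 2 Lf, ψ i (latticeMomentum Lf q) * torusChar q (x' - y)) := by
    intro x'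
    rw [overlapKernel_eq, Fintype.sum_prod_type, Finset.mul_sum]
    refine Finset.sum_congr rfl fun i _ => ?_
    rw [← inv_mul_sum_overlapSummand_eq hβ _ (ψ i) (x' - y)]
    congr 1
    exact Finset.sum_congr rfl fun q _ => overlapSummand_zero_eq hβ 𝔣' 𝔣 F'Lf hF'Lf FLf hFLf ω' ω y₀ x₀ y x' ψ hψ i q
  have hcoarse :
      (sectorAnalysisMatrix L M β F'L * sectorSubMatrix L M β FL)
          ((y₀, fun i => (((y i).val : ℕ) : ZMod L)), ((ω', σ), 0)) ((x₀, xbar), ((ω, σ), 0)) =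
        ∑ i : MatsubaraIdx M,
          (Complex.exp (((Real.pi * (1 - 2 * M) * (((x₀ : ℕ) : ℝ) - ((y₀ : ℕ) : ℝ)) / (2 * M) : ℝ) : ℂ) * I) *
              torusChar (fun _ : Fin 1 => ((i : ℕ) : ZMod (2 * M))) (fun _ : Fin 1 => ((x₀ : ℕ) : ZMod (2 * M)) - ((y₀ : ℕ) : ZMod (2 * M)))) /
              (β : ℂ) *
            (((L : ℂ) ^ 2)⁻¹ * ∑ q : TorusSite 2 L, ψ i (latticeMomentum L q) * torusChar q (xbar - fun j => (((y j).val : ℕ) : ZMod L))) := by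
    rw [overlapKernel_eq, Fintype.sum_prod_type, Finset.mul_sum]
    refine Finset.sum_congr rfl fun i _ => ?_
    rw [← inv_mul_sum_overlapSummand_eq hβ _ (ψ i) _]
    congr 1
    exact Finset.sum_congr rfl fun q _ => overlapSummand_zero_eq hβ 𝔣' 𝔣 F'L hF'L FL hFL ω' ω y₀ x₀ _ xbar ψ hψ i q
  simp_rw [hfine]
  rw [hcoarse, Finset.sum_comm]
  refine Finset.sum_congr rfl fun i _ => ?_
  rw [← Finset.mul_sum, periodise_spatialPropagator_left hLf (ψ i) y xbar]

/-- **Charge `1`: the same** (spatial character `χ_q(y⃗ − x⃗′)`, `periodise_spatialPropagator`). [folklore] -/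
theorem sectorOverlap_one_periodise (hLf : Lf = b * L) {β : ℝ} (hβ : β ≠ 0)
    (𝔣' : Fin N' → MatsubaraIdx M → (Fin 2 → ℝ) → ℂ) (𝔣 : Fin N → MatsubaraIdx M → (Fin 2 → ℝ) → ℂ)
    (F'L : Fin N' → FreqMomentum L M → ℂ) (F'Lf : Fin N' → FreqMomentum Lf M → ℂ)
    (hF'L : ∀ ω i q, F'L ω (i, q) = 𝔣' ω i (latticeMomentum L q)) (hF'Lf : ∀ ω i q, F'Lf ω (i, q) = 𝔣' ω i (latticeMomentum Lf q))
    (FL : Fin N → FreqMomentum L M → ℂ) (FLf : Fin N → FreqMomentum Lf M → ℂ)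
    (hFL : ∀ ω i q, FL ω (i, q) = 𝔣 ω i (latticeMomentum L q)) (hFLf : ∀ ω i q, FLf ω (i, q) = 𝔣 ω i (latticeMomentum Lf q))
    (y₀ x₀ : ImagTimeIdx M) (y : TorusSite 2 Lf) (xbar : TorusSite 2 L) (ω' : Fin N') (ω : Fin N) (σ : Fin 2) :
    ∑ x' ∈ univ.filter (fun x' : TorusSite 2 Lf => (fun i => (((x' i).val : ℕ) : ZMod L)) = xbar),
        (sectorAnalysisMatrix Lf M β F'Lf * sectorSubMatrix Lf M β FLf) ((y₀, y), ((ω', σ), 1)) ((x₀, x'), ((ω, σ), 1)) =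
      (sectorAnalysisMatrix L M β F'L * sectorSubMatrix L M β FL)
        ((y₀, fun i => (((y i).val : ℕ) : ZMod L)), ((ω', σ), 1)) ((x₀, xbar), ((ω, σ), 1)) := by
  obtain ⟨ψ, hψ⟩ : ∃ ψ : MatsubaraIdx M → (Fin 2 → ℝ) → ℂ, ∀ i q', 𝔣' ω' i q' * 𝔣 ω i q' = ψ i q' := ⟨_, fun _ _ => rfl⟩
  have hfine : ∀ x' : TorusSite 2 Lf,
      (sectorAnalysisMatrix Lf M β F'Lf * sectorSubMatrix Lf M β FLf) ((y₀, y), ((ω', σ), 1)) ((x₀, x'), ((ω, σ), 1)) =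
        ∑ i : MatsubaraIdx M,
          (Complex.exp (((Real.pi * (1 - 2 * M) * (((y₀ : ℕ) : ℝ) - ((x₀ : ℕ) : ℝ)) / (2 * M) : ℝ) : ℂ) * I) *
              torusChar (fun _ : Fin 1 => ((i : ℕ) : ZMod (2 * M))) (fun _ : Fin 1 => ((y₀ : ℕ) : ZMod (2 * M)) - ((x₀ : ℕ) : ZMod (2 * M)))) /
              (β : ℂ) *
            (((Lf : ℂ) ^ 2)⁻¹ * ∑ q : TorusSite 2 Lf, ψ i (latticeMomentum Lf q) * torusChar q (y - x')) := by
    intro x'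
    rw [overlapKernel_eq, Fintype.sum_prod_type, Finset.mul_sum]
    refine Finset.sum_congr rfl fun i _ => ?_
    rw [← inv_mul_sum_overlapSummand_eq hβ _ (ψ i) (y - x')]
    congr 1
    exact Finset.sum_congr rfl fun q _ => overlapSummand_one_eq hβ 𝔣' 𝔣 F'Lf hF'Lf FLf hFLf ω' ω y₀ x₀ y x' ψ hψ i q
  have hcoarse :
      (sectorAnalysisMatrix L M β F'L * sectorSubMatrix L M β FL)
          ((y₀, fun i => (((y i).val : ℕ) : ZMod L)), ((ω', σ), 1)) ((x₀, xbar), ((ω, σ), 1)) =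
        ∑ i : MatsubaraIdx M,
          (Complex.exp (((Real.pi * (1 - 2 * M) * (((y₀ : ℕ) : ℝ) - ((x₀ : ℕ) : ℝ)) / (2 * M) : ℝ) : ℂ) * I) *
              torusChar (fun _ : Fin 1 => ((i : ℕ) : ZMod (2 * M))) (fun _ : Fin 1 => ((y₀ : ℕ) : ZMod (2 * M)) - ((x₀ : ℕ) : ZMod (2 * M)))) /
              (β : ℂ) *
            (((L : ℂ) ^ 2)⁻¹ * ∑ q : TorusSite 2 L, ψ i (latticeMomentum L q) * torusChar q ((fun j => (((y j).val : ℕ) : ZMod L)) - xbar)) := by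
    rw [overlapKernel_eq, Fintype.sum_prod_type, Finset.mul_sum]
    refine Finset.sum_congr rfl fun i _ => ?_
    rw [← inv_mul_sum_overlapSummand_eq hβ _ (ψ i) _]
    congr 1
    exact Finset.sum_congr rfl fun q _ => overlapSummand_one_eq hβ 𝔣' 𝔣 F'L hF'L FL hFL ω' ω y₀ x₀ _ xbar ψ hψ i q
  simp_rw [hfine]
  rw [hcoarse, Finset.sum_comm]
  refine Finset.sum_congr rfl fun i _ => ?_
  rw [← Finset.mul_sum, periodise_spatialPropagator hLf (ψ i) y xbar]

/-! ## §3 `(P_t)` at every pair of labels -/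

/-- **`(P_t)` AT EVERY PAIR OF LABELS for the overlap kernel.**  For `Lf = b·L`, `β ≠ 0`, the same sampled families at both volumes, and a block structure
`e₁` of the fine COLUMN labels whose projection is `((x₀,x⃗),ℓ) ↦ ((x₀, red x⃗), ℓ)`: the fine overlap kernel summed over the fibre of a coarse column label
is the coarse overlap kernel at the projected row — `Σ_{π Y″ = Y} (E′_{Lf}S_{Lf}) X′ Y″ = (E′_L S_L) (π X′) Y` (the periodisation hypothesis of the
substitution–gluing bracket of the two-volume pass, VL-STUB-ROUTE-A-g8.md §3 (iv)). [folklore] -/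
theorem sectorOverlap_periodise_leg (hLf : Lf = b * L) {β : ℝ} (hβ : β ≠ 0)
    (𝔣' : Fin N' → MatsubaraIdx M → (Fin 2 → ℝ) → ℂ) (𝔣 : Fin N → MatsubaraIdx M → (Fin 2 → ℝ) → ℂ)
    (F'L : Fin N' → FreqMomentum L M → ℂ) (F'Lf : Fin N' → FreqMomentum Lf M → ℂ)
    (hF'L : ∀ ω i q, F'L ω (i, q) = 𝔣' ω i (latticeMomentum L q)) (hF'Lf : ∀ ω i q, F'Lf ω (i, q) = 𝔣' ω i (latticeMomentum Lf q))
    (FL : Fin N → FreqMomentum L M → ℂ) (FLf : Fin N → FreqMomentum Lf M → ℂ)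
    (hFL : ∀ ω i q, FL ω (i, q) = 𝔣 ω i (latticeMomentum L q)) (hFLf : ∀ ω i q, FLf ω (i, q) = 𝔣 ω i (latticeMomentum Lf q))
    {ι : Type*} (e₁ : (SpaceTimeIdx Lf M × SectorLeg N) ≃ ι × (SpaceTimeIdx L M × SectorLeg N))
    (he₁ : ∀ X', (e₁ X').2 = ((X'.1.1, fun i => (((X'.1.2 i).val : ℕ) : ZMod L)), X'.2))
    (X' : SpaceTimeIdx Lf M × SectorLeg N') (Y : SpaceTimeIdx L M × SectorLeg N) :
    ∑ Y'' ∈ univ.filter (fun Y'' : SpaceTimeIdx Lf M × SectorLeg N => (e₁ Y'').2 = Y),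
        (sectorAnalysisMatrix Lf M β F'Lf * sectorSubMatrix Lf M β FLf) X' Y'' =
      (sectorAnalysisMatrix L M β F'L * sectorSubMatrix L M β FL) ((X'.1.1, fun i => (((X'.1.2 i).val : ℕ) : ZMod L)), X'.2) Y := by
  classical
  -- the fibre of the label `Y` is the site fibre of its site, at the time/sector leg of `Y`
  have hfib : ∑ Y'' ∈ univ.filter (fun Y'' : SpaceTimeIdx Lf M × SectorLeg N => (e₁ Y'').2 = Y),
        (sectorAnalysisMatrix Lf M β F'Lf * sectorSubMatrix Lf M β FLf) X' Y'' =
      ∑ x' ∈ univ.filter (fun x' : TorusSite 2 Lf => (fun i => (((x' i).val : ℕ) : ZMod L)) = Y.1.2),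
        (sectorAnalysisMatrix Lf M β F'Lf * sectorSubMatrix Lf M β FLf) X' ((Y.1.1, x'), Y.2) := by
    refine Finset.sum_bij' (fun Y'' _ => Y''.1.2) (fun x' _ => ((Y.1.1, x'), Y.2)) ?_ ?_ ?_ ?_ ?_
    · intro Y'' hY''
      simp only [mem_filter, mem_univ, true_and] at hY'' ⊢
      rw [he₁] at hY''; rw [← hY'']
    · intro x' hx'
      simp only [mem_filter, mem_univ, true_and] at hx' ⊢
      rw [he₁, hx']
    · intro Y'' hY''
      simp only [mem_filter, mem_univ, true_and] at hY''
      rw [he₁] at hY''; rw [← hY'']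
    · intro x' hx'; rfl
    · intro Y'' hY''
      simp only [mem_filter, mem_univ, true_and] at hY''
      rw [he₁] at hY''; rw [← hY'']
  rw [hfib]
  obtain ⟨⟨y₀, y⟩, ⟨⟨ω', σ'⟩, c'⟩⟩ := X'
  obtain ⟨⟨x₀, xbar⟩, ⟨⟨ω, σ⟩, c⟩⟩ := Y
  dsimp only
  by_cases h : σ = σ' ∧ c = c'
  · obtain ⟨hσ, hc⟩ := h
    subst hσ; subst hc
    fin_cases c
    · exact sectorOverlap_zero_periodise hLf hβ 𝔣' 𝔣 F'L F'Lf hF'L hF'Lf FL FLf hFL hFLf y₀ x₀ y xbar ω' ω σ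
    · exact sectorOverlap_one_periodise hLf hβ 𝔣' 𝔣 F'L F'Lf hF'L hF'Lf FL FLf hFL hFLf y₀ x₀ y xbar ω' ω σ
  · -- different spins or charges: both sides vanish
    rw [sectorAnalysis_mul_sectorSub_apply, if_neg h]
    exact sum_eq_zero fun x' _ => by rw [sectorAnalysis_mul_sectorSub_apply, if_neg h]

end Periodise

/-! ## §4 Spatial translation covariance of the overlap kernel -/

section Translate

variable {V M N N' : ℕ} [NeZero V] [NeZero M]

/-- **The overlap kernel is spatially translation-covariant**: shifting the sites of row and column by the same `z ∈ (ℤ/Vℤ)²` (times fixed) does not change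
`(E′S)((y₀,y⃗),(ω′,σ′,c′))((x₀,x⃗),(ω,σ,c))` — any multiplier families (`β ≠ 0`).  Behind the winding column tails of the substitution–gluing bracket (a box
shift moves the column's box to the reference box). [folklore] -/
theorem sectorOverlap_translate {β : ℝ} (hβ : β ≠ 0) (F' : Fin N' → FreqMomentum V M → ℂ) (F : Fin N → FreqMomentum V M → ℂ)
    (y₀ x₀ : ImagTimeIdx M) (y x z : TorusSite 2 V) (ℓ' : SectorLeg N') (ℓ : SectorLeg N) :
    (sectorAnalysisMatrix V M β F' * sectorSubMatrix V M β F) ((y₀, y + z), ℓ') ((x₀, x + z), ℓ) =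
      (sectorAnalysisMatrix V M β F' * sectorSubMatrix V M β F) ((y₀, y), ℓ') ((x₀, x), ℓ) := by
  obtain ⟨⟨ω', σ'⟩, c'⟩ := ℓ'
  obtain ⟨⟨ω, σ⟩, c⟩ := ℓ
  by_cases h : σ = σ' ∧ c = c'
  · obtain ⟨hσ, hc⟩ := h
    subst hσ; subst hc
    rw [overlapKernel_eq, overlapKernel_eq]
    congr 1
    refine Finset.sum_congr rfl fun k _ => ?_
    fin_cases c
    · simp only [Fin.zero_eta, Fin.isValue]
      rw [overlapPhase_zero, overlapPhase_zero, conj_hubbardPlaneWave_mul_conj_hubbardPlaneWave (L := V) (M := M) hβ k (x₀, x + z) (y₀, y + z),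
        conj_hubbardPlaneWave_mul_conj_hubbardPlaneWave (L := V) (M := M) hβ k (x₀, x) (y₀, y)]
      dsimp only
      rw [add_sub_add_right_eq_sub]
    · simp only [Fin.mk_one, Fin.isValue]
      rw [overlapPhase_one, overlapPhase_one, conj_hubbardPlaneWave_mul_conj_hubbardPlaneWave (L := V) (M := M) hβ k (y₀, y + z) (x₀, x + z),
        conj_hubbardPlaneWave_mul_conj_hubbardPlaneWave (L := V) (M := M) hβ k (y₀, y) (x₀, x)]
      dsimp only
      rw [add_sub_add_right_eq_sub]
  · have h1 : ¬ ((((x₀, x + z), ((ω, σ), c)) : SpaceTimeIdx V M × SectorLeg N).2.1.2 =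
          (((y₀, y + z), ((ω', σ'), c')) : SpaceTimeIdx V M × SectorLeg N').2.1.2 ∧
        (((x₀, x + z), ((ω, σ), c)) : SpaceTimeIdx V M × SectorLeg N).2.2 = (((y₀, y + z), ((ω', σ'), c')) : SpaceTimeIdx V M × SectorLeg N').2.2) := h
    have h2 : ¬ ((((x₀, x), ((ω, σ), c)) : SpaceTimeIdx V M × SectorLeg N).2.1.2 =
          (((y₀, y), ((ω', σ'), c')) : SpaceTimeIdx V M × SectorLeg N').2.1.2 ∧
        (((x₀, x), ((ω, σ), c)) : SpaceTimeIdx V M × SectorLeg N).2.2 = (((y₀, y), ((ω', σ'), c')) : SpaceTimeIdx V M × SectorLeg N').2.2) := h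
    rw [sectorAnalysis_mul_sectorSub_apply, if_neg h1, sectorAnalysis_mul_sectorSub_apply, if_neg h2]

end Translate

end Summit.HubbardSuperconductivity.HubbardSuperconductivity.Theorems.TwoPointAssembly

end
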